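import Mathlib.Analysis.Complex.ExponentialBounds
import Literature.NumberTheory.Transcendental.KhovCode
import HarnessLib

/-!
# Certified Khovanskii codes: width calculus of the box enclosures

Companion proof file of `Literature/NumberTheory/Transcendental/KhovCode.lean` (definition
request `defn-KhovCode`, route `Schanuel/ArithmeticalComplexity`). The certificate
`KhovCode.Cert` is *sound* (`KhovCode.cert_sound`); for its *completeness* (sibling file
`KhovCodeComplete.lean`: every non-degenerate zero passes the test for suitable data) one needs
that the rational box enclosures shrink with their arguments and with the precision. This file
proves the standard a priori estimates of interval arithmetic (Moore 1966, Ch. 2–4; Neumaier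
1990, §1.3–§2.3 "Lipschitz property of arithmetical expressions") for the exact rational
rectangular arithmetic `CBox` of the main file:

* magnitude `M = CBox.mag` and width `W = CBox.width` of `add/sub/mul/smul/npow/widen/lsum/lprod`:
  `W(A B) ≤ M(A) W(B) + M(B) W(A)`, `M(A B) ≤ M(A) M(B)` (`CBox.width_mul_le`,
  `CBox.mag_mul_le`, from `CBox.length_mooreMul_le`, `CBox.intervalMag_mooreMul_le`), …;
* the exponential: `CBox.width_mag_cexp_le` — on boxes with `normSqHi ≤ μ` there is `C` with
  `W(cexp N Z) ≤ C (W(Z) + expRem (N+1))` and `M(cexp N Z) ≤ C`, where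
  `expRem (N+1) ≤ (1/2)^N` (`CBox.expRem_succ_le`);
* integer polynomials: `CBox.width_mag_polyEncl_le` — for argument boxes of magnitude `≤ μ`
  there is `C` with `W(polyEncl p A) ≤ C ∑ₖ W(A k)` and `M(polyEncl p A) ≤ C`;
* `CBox.mag_le_of_mem`, `CBox.normSqHi_le_of_mem` — a box containing a known point `z` has
  magnitude `≤ |Re z| + |Im z| + W` and `normSqHi ≤ 2 (‖z‖ + W)²`.

All statements are theorems (no new definitions); constants are existential (only their
independence of the widths and of the precision matters downstream).

## References

* R. E. Moore, *Interval Analysis*, Prentice-Hall 1966, Ch. 2–4.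
* A. Neumaier, *Interval Methods for Systems of Equations*, Cambridge UP 1990, §1.3, §2.3,
  Thm 5.2.2 (radii of Krawczyk iterates shrink linearly).
-/

noncomputable section

open NonemptyInterval MvPolynomial

namespace Literature.NumberTheory.Transcendental

open Literature.Analysis.ValidatedNumerics

namespace CBox

/-! ### Interval facts -/

section Interval

variable {I J : NonemptyInterval ℚ}

/-- [folklore] -/
theorem intervalMag_pure (q : ℚ) : intervalMag (pure q) = |q| := by simp [intervalMag]

/-- [folklore] -/
theorem abs_le_intervalMag_of_mem {x : ℚ} (hx : x ∈ I) : |x| ≤ intervalMag I := by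
  have h := abs_le_intervalMag (I := I) (x := (x : ℝ)) (cast_mem_ratCast_iff.2 hx)
  exact_mod_cast h

/-- [folklore] -/
theorem fst_mem (I : NonemptyInterval ℚ) : I.fst ∈ I := ⟨le_rfl, I.fst_le_snd⟩

/-- [folklore] -/
theorem snd_mem (I : NonemptyInterval ℚ) : I.snd ∈ I := ⟨I.fst_le_snd, le_rfl⟩

/-- [folklore] -/
theorem abs_fst_le (I : NonemptyInterval ℚ) : |I.fst| ≤ intervalMag I := le_max_left _ _

/-- [folklore] -/
theorem abs_snd_le (I : NonemptyInterval ℚ) : |I.snd| ≤ intervalMag I := le_max_right _ _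

/-- Two members of an interval differ by at most its length. [folklore] -/
theorem abs_sub_le_length {x y : ℚ} (hx : x ∈ I) (hy : y ∈ I) : |x - y| ≤ I.length := by
  obtain ⟨hx1, hx2⟩ : I.fst ≤ x ∧ x ≤ I.snd := hx
  obtain ⟨hy1, hy2⟩ : I.fst ≤ y ∧ y ≤ I.snd := hy
  rw [NonemptyInterval.length, abs_sub_le_iff]; constructor <;> linarith

/-- The key estimate for the Moore product: `x y - x' y' ≤ mag I · len J + mag J · len I` for
`x, x' ∈ I`, `y, y' ∈ J`. [cite: Moore1966, §2.2] -/
theorem mul_sub_mul_le {x x' y y' : ℚ} (hx : x ∈ I) (hx' : x' ∈ I) (hy : y ∈ J) (hy' : y' ∈ J) :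
    x * y - x' * y' ≤ intervalMag I * J.length + intervalMag J * I.length := by
  have h1 : x * (y - y') ≤ intervalMag I * J.length := by
    calc x * (y - y') ≤ |x * (y - y')| := le_abs_self _
      _ = |x| * |y - y'| := abs_mul _ _
      _ ≤ intervalMag I * J.length := mul_le_mul (abs_le_intervalMag_of_mem hx)
          (abs_sub_le_length hy hy') (abs_nonneg _) (intervalMag_nonneg _)
  have h2 : y' * (x - x') ≤ intervalMag J * I.length := by
    calc y' * (x - x') ≤ |y' * (x - x')| := le_abs_self _
      _ = |y'| * |x - x'| := abs_mul _ _
      _ ≤ intervalMag J * I.length := mul_le_mul (abs_le_intervalMag_of_mem hy')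
          (abs_sub_le_length hx hx') (abs_nonneg _) (intervalMag_nonneg _)
  nlinarith

/-- **Width of the Moore product.** [cite: Moore1966, §2.2] -/
theorem length_mooreMul_le (I J : NonemptyInterval ℚ) :
    (I.mooreMul J).length ≤ intervalMag I * J.length + intervalMag J * I.length := by
  set B := intervalMag I * J.length + intervalMag J * I.length
  have key : ∀ p ∈ [I.fst * J.fst, I.fst * J.snd, I.snd * J.fst, I.snd * J.snd],
      ∀ p' ∈ [I.fst * J.fst, I.fst * J.snd, I.snd * J.fst, I.snd * J.snd], p - p' ≤ B := by
    intro p hp p' hp'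
    simp only [List.mem_cons, List.mem_nil_iff, or_false] at hp hp'
    rcases hp with rfl | rfl | rfl | rfl <;> rcases hp' with rfl | rfl | rfl | rfl <;>
      exact mul_sub_mul_le (by first | exact fst_mem I | exact snd_mem I)
        (by first | exact fst_mem I | exact snd_mem I)
        (by first | exact fst_mem J | exact snd_mem J) (by first | exact fst_mem J | exact snd_mem J)
  rw [NonemptyInterval.length, fst_mooreMul, snd_mooreMul, sub_le_iff_le_add]
  have h : ∀ p ∈ [I.fst * J.fst, I.fst * J.snd, I.snd * J.fst, I.snd * J.snd],
      p ≤ B + min (min (I.fst * J.fst) (I.fst * J.snd)) (min (I.snd * J.fst) (I.snd * J.snd)) := by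
    intro p hp
    have h' : ∀ p' ∈ [I.fst * J.fst, I.fst * J.snd, I.snd * J.fst, I.snd * J.snd], p - B ≤ p' :=
      fun p' hp' => by linarith [key p hp p' hp']
    have := le_min (le_min (h' (I.fst * J.fst) (by simp)) (h' (I.fst * J.snd) (by simp)))
      (le_min (h' (I.snd * J.fst) (by simp)) (h' (I.snd * J.snd) (by simp)))
    linarith
  exact max_le (max_le (h (I.fst * J.fst) (by simp)) (h (I.fst * J.snd) (by simp)))
    (max_le (h (I.snd * J.fst) (by simp)) (h (I.snd * J.snd) (by simp)))

/-- **Magnitude of the Moore product.** [cite: Moore1966, §2.2] -/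
theorem intervalMag_mooreMul_le (I J : NonemptyInterval ℚ) :
    intervalMag (I.mooreMul J) ≤ intervalMag I * intervalMag J := by
  set B := intervalMag I * intervalMag J
  have key : ∀ p ∈ [I.fst * J.fst, I.fst * J.snd, I.snd * J.fst, I.snd * J.snd], |p| ≤ B := by
    intro p hp
    simp only [List.mem_cons, List.mem_nil_iff, or_false] at hp
    rcases hp with rfl | rfl | rfl | rfl <;> rw [abs_mul] <;>
      exact mul_le_mul (by first | exact abs_fst_le I | exact abs_snd_le I)
        (by first | exact abs_fst_le J | exact abs_snd_le J) (abs_nonneg _) (intervalMag_nonneg _)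
  have hlo : -B ≤ (I.mooreMul J).fst := by
    rw [fst_mooreMul]
    refine le_min (le_min ?_ ?_) (le_min ?_ ?_) <;> exact (abs_le.1 (key _ (by simp))).1
  have hhi : (I.mooreMul J).snd ≤ B := by
    rw [snd_mooreMul]
    refine max_le (max_le ?_ ?_) (max_le ?_ ?_) <;> exact (abs_le.1 (key _ (by simp))).2
  have hmid := (I.mooreMul J).fst_le_snd
  exact max_le (abs_le.2 ⟨hlo, hmid.trans hhi⟩) (abs_le.2 ⟨by linarith, hhi⟩)

/-- [folklore] -/
theorem intervalMag_add_le (I J : NonemptyInterval ℚ) :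
    intervalMag (I + J) ≤ intervalMag I + intervalMag J := by
  unfold intervalMag
  rw [fst_add, snd_add]
  exact max_le ((abs_add_le _ _).trans (add_le_add (le_max_left _ _) (le_max_left _ _)))
    ((abs_add_le _ _).trans (add_le_add (le_max_right _ _) (le_max_right _ _)))

/-- [folklore] -/
theorem intervalMag_sub_le (I J : NonemptyInterval ℚ) :
    intervalMag (I - J) ≤ intervalMag I + intervalMag J := by
  unfold intervalMag
  rw [fst_sub, snd_sub]
  exact max_le ((abs_sub _ _).trans (add_le_add (le_max_left _ _) (le_max_right _ _)))
    ((abs_sub _ _).trans (add_le_add (le_max_right _ _) (le_max_left _ _)))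

/-- [folklore] -/
theorem length_symmInterval (ρ : ℚ) : (symmInterval ρ).length = 2 * |ρ| := by
  simp [symmInterval, NonemptyInterval.length]; ring

/-- [folklore] -/
theorem intervalMag_symmInterval (ρ : ℚ) : intervalMag (symmInterval ρ) = |ρ| := by
  simp [symmInterval, intervalMag]

/-- `mag I ≤ |x| + len I` for a member `x`. [folklore] -/
theorem intervalMag_le_abs_add_length {x : ℝ} (hx : x ∈ I.ratCast ℝ) :
    (intervalMag I : ℝ) ≤ |x| + I.length := by
  obtain ⟨h1, h2⟩ := mem_ratCast_iff.1 hx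
  have hlen : ((I.length : ℚ) : ℝ) = (I.snd : ℝ) - I.fst := by
    rw [NonemptyInterval.length, Rat.cast_sub]
  simp only [intervalMag, Rat.cast_max, Rat.cast_abs, hlen]
  refine max_le ?_ ?_
  · rw [abs_le]; constructor <;> linarith [le_abs_self x, neg_abs_le x]
  · rw [abs_le]; constructor <;> linarith [le_abs_self x, neg_abs_le x]

end Interval

/-! ### Width and magnitude of the box operations -/

variable {A B : CBox}

/-- [folklore] -/
theorem width_add (A B : CBox) : width (add A B) = width A + width B := by
  simp only [width, add, length_add]; ring

/-- [folklore] -/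
theorem width_sub (A B : CBox) : width (sub A B) = width A + width B := by
  simp only [width, sub, length_sub]; ring

/-- [folklore] -/
theorem mag_add_le (A B : CBox) : mag (add A B) ≤ mag A + mag B := by
  have h1 := intervalMag_add_le A.re B.re
  have h2 := intervalMag_add_le A.im B.im
  simp only [mag, add]; linarith

/-- [folklore] -/
theorem mag_sub_le (A B : CBox) : mag (sub A B) ≤ mag A + mag B := by
  have h1 := intervalMag_sub_le A.re B.re
  have h2 := intervalMag_sub_le A.im B.im
  simp only [mag, sub]; linarith

/-- **Width of the box product**: `W(AB) ≤ M(A) W(B) + M(B) W(A)`. [cite: Moore1966, §2.2] -/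
theorem width_mul_le (A B : CBox) : width (mul A B) ≤ mag A * width B + mag B * width A := by
  have h1 := length_mooreMul_le A.re B.re
  have h2 := length_mooreMul_le A.im B.im
  have h3 := length_mooreMul_le A.re B.im
  have h4 := length_mooreMul_le A.im B.re
  simp only [width, mul, mag, length_sub, length_add]
  nlinarith [intervalMag_nonneg A.re, intervalMag_nonneg A.im, intervalMag_nonneg B.re,
    intervalMag_nonneg B.im, length_nonneg A.re, length_nonneg A.im, length_nonneg B.re,
    length_nonneg B.im]

/-- **Magnitude of the box product**: `M(AB) ≤ M(A) M(B)`. [cite: Moore1966, §2.2] -/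
theorem mag_mul_le (A B : CBox) : mag (mul A B) ≤ mag A * mag B := by
  have h1 := intervalMag_mooreMul_le A.re B.re
  have h2 := intervalMag_mooreMul_le A.im B.im
  have h3 := intervalMag_mooreMul_le A.re B.im
  have h4 := intervalMag_mooreMul_le A.im B.re
  have h5 := intervalMag_sub_le (A.re.mooreMul B.re) (A.im.mooreMul B.im)
  have h6 := intervalMag_add_le (A.re.mooreMul B.im) (A.im.mooreMul B.re)
  simp only [mag, mul]
  nlinarith [intervalMag_nonneg A.re, intervalMag_nonneg A.im, intervalMag_nonneg B.re,
    intervalMag_nonneg B.im]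

/-- [folklore] -/
theorem width_smul_le (q : ℚ) (A : CBox) : width (smul q A) ≤ |q| * width A := by
  have h1 := length_mooreMul_le (pure q) A.re
  have h2 := length_mooreMul_le (pure q) A.im
  simp only [intervalMag_pure, length_pure, mul_zero, add_zero] at h1 h2
  simp only [width, smul]
  nlinarith

/-- [folklore] -/
theorem mag_smul_le (q : ℚ) (A : CBox) : mag (smul q A) ≤ |q| * mag A := by
  have h1 := intervalMag_mooreMul_le (pure q) A.re
  have h2 := intervalMag_mooreMul_le (pure q) A.im
  simp only [intervalMag_pure] at h1 h2
  simp only [mag, smul]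
  nlinarith

/-- [folklore] -/
theorem mag_ofRat (q : ℚ × ℚ) : mag (ofRat q) = |q.1| + |q.2| := by
  simp [mag, ofRat, intervalMag_pure]

/-- [folklore] -/
theorem mag_one : mag CBox.one = 1 := by simp [CBox.one, mag_ofRat]

/-- [folklore] -/
theorem width_one : width CBox.one = 0 := width_ofRat _

/-- [folklore] -/
theorem mag_zero : mag CBox.zero = 0 := by simp [CBox.zero, mag_ofRat]

/-- [folklore] -/
theorem width_zero : width CBox.zero = 0 := width_ofRat _

/-- [folklore] -/
theorem mag_npow_le (A : CBox) (k : ℕ) : mag (npow A k) ≤ mag A ^ k := by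
  induction k with
  | zero => simp [npow, mag_one]
  | succ k ih =>
    rw [pow_succ]
    exact (mag_mul_le _ _).trans (mul_le_mul_of_nonneg_right ih (mag_nonneg _))

/-- `W(A^{k+1}) ≤ (k+1) M(A)^k W(A)`. [folklore] -/
theorem width_npow_succ_le (A : CBox) (k : ℕ) :
    width (npow A (k + 1)) ≤ (k + 1) * mag A ^ k * width A := by
  induction k with
  | zero =>
    have h := width_mul_le CBox.one A
    rw [mag_one, width_one, mul_zero, add_zero, one_mul] at h
    simpa [npow] using h
  | succ k ih =>
    have h := width_mul_le (npow A (k + 1)) A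
    have hm := mag_npow_le A (k + 1)
    have hw := width_nonneg A
    have hmA := mag_nonneg A
    calc width (npow A (k + 1 + 1)) = width (mul (npow A (k + 1)) A) := rfl
      _ ≤ mag (npow A (k + 1)) * width A + mag A * width (npow A (k + 1)) := h
      _ ≤ mag A ^ (k + 1) * width A + mag A * ((k + 1) * mag A ^ k * width A) := by
          gcongr
      _ = ((k + 1 : ℕ) + 1 : ℚ) * mag A ^ (k + 1) * width A := by push_cast; ring

/-- [folklore] -/
theorem width_widen (A : CBox) (ρ : ℚ) : width (widen A ρ) = width A + 4 * |ρ| := by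
  simp only [width, widen, length_add, length_symmInterval]; ring

/-- [folklore] -/
theorem mag_widen_le (A : CBox) (ρ : ℚ) : mag (widen A ρ) ≤ mag A + 2 * |ρ| := by
  have h1 := intervalMag_add_le A.re (symmInterval ρ)
  have h2 := intervalMag_add_le A.im (symmInterval ρ)
  rw [intervalMag_symmInterval] at h1 h2
  simp only [mag, widen]; linarith

/-- [folklore] -/
theorem width_lsum_le {ι : Type*} (l : List ι) (f : ι → CBox) (ω : ι → ℚ)
    (h : ∀ k ∈ l, width (f k) ≤ ω k) : width (lsum l f) ≤ (l.map ω).sum := by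
  induction l with
  | nil => simp [lsum, width_zero]
  | cons a l ih =>
    rw [List.map_cons, List.sum_cons]
    calc width (lsum (a :: l) f) = width (add (f a) (lsum l f)) := rfl
      _ = width (f a) + width (lsum l f) := width_add _ _
      _ ≤ ω a + (l.map ω).sum := add_le_add (h a (by simp)) (ih fun k hk => h k (by simp [hk]))

/-- [folklore] -/
theorem mag_lsum_le {ι : Type*} (l : List ι) (f : ι → CBox) (μ : ι → ℚ)
    (h : ∀ k ∈ l, mag (f k) ≤ μ k) : mag (lsum l f) ≤ (l.map μ).sum := by
  induction l with
  | nil => simp [lsum, mag_zero]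
  | cons a l ih =>
    rw [List.map_cons, List.sum_cons]
    calc mag (lsum (a :: l) f) = mag (add (f a) (lsum l f)) := rfl
      _ ≤ mag (f a) + mag (lsum l f) := mag_add_le _ _
      _ ≤ μ a + (l.map μ).sum := add_le_add (h a (by simp)) (ih fun k hk => h k (by simp [hk]))

/-- Magnitude and width of a product of boxes with uniformly bounded magnitudes `≤ μ`,
`1 ≤ μ`. [folklore] -/
theorem mag_width_lprod_le {ι : Type*} (l : List ι) (f : ι → CBox) {μ : ℚ} (hμ : 1 ≤ μ)
    (ω : ι → ℚ) (hω : ∀ k ∈ l, 0 ≤ ω k) (h : ∀ k ∈ l, mag (f k) ≤ μ ∧ width (f k) ≤ ω k) :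
    mag (lprod l f) ≤ μ ^ l.length ∧ width (lprod l f) ≤ μ ^ l.length * (l.map ω).sum := by
  induction l with
  | nil => simp [lprod, mag_one, width_one]
  | cons a l ih =>
    obtain ⟨ihm, ihw⟩ := ih (fun k hk => hω k (by simp [hk])) (fun k hk => h k (by simp [hk]))
    obtain ⟨hma, hwa⟩ := h a (by simp)
    have hωa := hω a (by simp)
    have hsum : 0 ≤ (l.map ω).sum :=
      List.sum_nonneg (by
        intro x hx
        obtain ⟨k, hk, rfl⟩ := List.mem_map.1 hx
        exact hω k (by simp [hk]))
    have hμ0 : 0 ≤ μ := zero_le_one.trans hμ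
    have hP0 : 0 ≤ mag (lprod l f) := mag_nonneg _
    have hfa0 : 0 ≤ mag (f a) := mag_nonneg _
    have hW0 : 0 ≤ width (lprod l f) := width_nonneg _
    have hpow : μ ^ l.length ≤ μ ^ (l.length + 1) := pow_le_pow_right₀ hμ (Nat.le_succ _)
    rw [List.length_cons, List.map_cons, List.sum_cons]
    constructor
    · calc mag (lprod (a :: l) f) = mag (mul (f a) (lprod l f)) := rfl
        _ ≤ mag (f a) * mag (lprod l f) := mag_mul_le _ _
        _ ≤ μ * μ ^ l.length := mul_le_mul hma ihm hP0 hμ0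
        _ = μ ^ (l.length + 1) := by ring
    · calc width (lprod (a :: l) f) = width (mul (f a) (lprod l f)) := rfl
        _ ≤ mag (f a) * width (lprod l f) + mag (lprod l f) * width (f a) := width_mul_le _ _
        _ ≤ μ * (μ ^ l.length * (l.map ω).sum) + μ ^ l.length * ω a :=
            add_le_add (mul_le_mul hma ihw hW0 hμ0)
              (mul_le_mul ihm hwa (width_nonneg _) (pow_nonneg hμ0 _))
        _ ≤ μ * (μ ^ l.length * (l.map ω).sum) + μ ^ (l.length + 1) * ω a := by
            have hstep : μ ^ l.length * ω a ≤ μ ^ (l.length + 1) * ω a :=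
              mul_le_mul_of_nonneg_right hpow hωa
            linarith
        _ = μ ^ (l.length + 1) * (ω a + (l.map ω).sum) := by ring

end CBox

namespace CBox

/-! ### The exponential enclosure: width and magnitude -/

variable {A B Z : CBox}

/-- `∑_{k<K} 1/k! ≤ 3` (from `e < 3`). [folklore] -/
theorem sum_inv_factorial_le (K : ℕ) : ∑ k ∈ Finset.range K, (1 / (k.factorial : ℚ)) ≤ 3 := by
  have h := Real.sum_le_exp_of_nonneg zero_le_one K
  simp only [one_pow] at h
  have h3 : Real.exp 1 ≤ 3 := Real.exp_one_lt_three.le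
  have : ((∑ k ∈ Finset.range K, (1 / (k.factorial : ℚ)) : ℚ) : ℝ) ≤ 3 := by
    push_cast; linarith
  exact_mod_cast this

/-- `∑_{m<N} m/m! ≤ 3`. [folklore] -/
theorem sum_div_factorial_le (N : ℕ) : ∑ m ∈ Finset.range N, ((m : ℚ) / m.factorial) ≤ 3 := by
  rcases N with _ | N
  · simp
  rw [Finset.sum_range_succ']
  have h : ∀ m : ℕ, ((m + 1 : ℕ) : ℚ) / ((m + 1).factorial : ℕ) = 1 / (m.factorial : ℚ) := by
    intro m
    rw [Nat.factorial_succ]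
    have : (m.factorial : ℚ) ≠ 0 := by positivity
    push_cast
    field_simp
  simp only [h, Nat.cast_zero, zero_div, add_zero]
  exact sum_inv_factorial_le N

/-- Width and magnitude of the Taylor enclosure on a box of magnitude `≤ 1`. [folklore] -/
theorem width_mag_expTaylor_le (hM : mag Z ≤ 1) (N : ℕ) :
    width (expTaylor Z N) ≤ (∑ m ∈ Finset.range N, ((m : ℚ) / m.factorial)) * width Z ∧
    mag (expTaylor Z N) ≤ ∑ m ∈ Finset.range N, (1 / (m.factorial : ℚ)) := by
  have hM0 := mag_nonneg Z
  have hW0 := width_nonneg Z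
  induction N with
  | zero => simp [expTaylor, width_zero, mag_zero]
  | succ N ih =>
    obtain ⟨ihw, ihm⟩ := ih
    have hterm_w : width (smul (1 / (N.factorial : ℚ)) (npow Z N)) ≤
        (N : ℚ) / N.factorial * width Z := by
      refine (width_smul_le _ _).trans ?_
      rw [abs_of_nonneg (by positivity)]
      rcases N with _ | k
      · simp [npow, width_one]
      · have h := width_npow_succ_le Z k
        have hMk : mag Z ^ k ≤ 1 := pow_le_one₀ hM0 hM
        calc 1 / ((k + 1).factorial : ℚ) * width (npow Z (k + 1))
            ≤ 1 / ((k + 1).factorial : ℚ) * ((k + 1) * mag Z ^ k * width Z) := by gcongr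
          _ ≤ 1 / ((k + 1).factorial : ℚ) * ((k + 1) * 1 * width Z) := by gcongr
          _ = ((k + 1 : ℕ) : ℚ) / (k + 1).factorial * width Z := by push_cast; ring
    have hterm_m : mag (smul (1 / (N.factorial : ℚ)) (npow Z N)) ≤ 1 / (N.factorial : ℚ) := by
      refine (mag_smul_le _ _).trans ?_
      rw [abs_of_nonneg (by positivity)]
      have := (mag_npow_le Z N).trans (pow_le_one₀ hM0 hM)
      calc 1 / (N.factorial : ℚ) * mag (npow Z N) ≤ 1 / (N.factorial : ℚ) * 1 := by gcongr
        _ = _ := mul_one _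
    rw [Finset.sum_range_succ, Finset.sum_range_succ]
    constructor
    · calc width (expTaylor Z (N + 1))
          = width (expTaylor Z N) + width (smul (1 / (N.factorial : ℚ)) (npow Z N)) := width_add _ _
        _ ≤ (∑ m ∈ Finset.range N, ((m : ℚ) / m.factorial)) * width Z +
            (N : ℚ) / N.factorial * width Z := add_le_add ihw hterm_w
        _ = _ := by ring
    · calc mag (expTaylor Z (N + 1))
          ≤ mag (expTaylor Z N) + mag (smul (1 / (N.factorial : ℚ)) (npow Z N)) := mag_add_le _ _
        _ ≤ _ := add_le_add ihm hterm_m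

/-- [folklore] -/
theorem width_expTaylor_le (hM : mag Z ≤ 1) (N : ℕ) : width (expTaylor Z N) ≤ 3 * width Z :=
  (width_mag_expTaylor_le hM N).1.trans
    (mul_le_mul_of_nonneg_right (sum_div_factorial_le N) (width_nonneg Z))

/-- [folklore] -/
theorem mag_expTaylor_le (hM : mag Z ≤ 1) (N : ℕ) : mag (expTaylor Z N) ≤ 3 :=
  (width_mag_expTaylor_le hM N).2.trans (sum_inv_factorial_le N)

/-- [folklore] -/
theorem expRem_nonneg (N : ℕ) : 0 ≤ expRem N := by unfold expRem; positivity

/-- `expRem (N+1) ≤ (1/2)^N`: the remainder bound tends to zero geometrically. [folklore] -/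
theorem expRem_succ_le (N : ℕ) : expRem (N + 1) ≤ (1 / 2) ^ N := by
  unfold expRem
  have hf : (1 : ℚ) ≤ (N + 1).factorial := by exact_mod_cast Nat.succ_le_of_lt (Nat.factorial_pos _)
  have hN : (0 : ℚ) ≤ N := by positivity
  have h1 : ((N + 1 : ℕ) + 1 : ℚ) / ((N + 1).factorial * (N + 1 : ℕ)) ≤ 2 := by
    rw [div_le_iff₀ (by positivity)]
    push_cast
    nlinarith
  calc (1 / 2 : ℚ) ^ (N + 1) * (((N + 1 : ℕ) + 1 : ℚ) / ((N + 1).factorial * (N + 1 : ℕ)))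
      ≤ (1 / 2 : ℚ) ^ (N + 1) * 2 := by gcongr
    _ = (1 / 2) ^ N := by rw [pow_succ]; ring

/-- [folklore] -/
theorem expRem_succ_le_one (N : ℕ) : expRem (N + 1) ≤ 1 :=
  (expRem_succ_le N).trans (pow_le_one₀ (by norm_num) (by norm_num))

/-- [folklore] -/
theorem width_expSmall_le (hM : mag Z ≤ 1) (N : ℕ) :
    width (expSmall N Z) ≤ 3 * width Z + 4 * expRem (N + 1) := by
  rw [expSmall, width_widen, abs_of_nonneg (expRem_nonneg _)]
  linarith [width_expTaylor_le hM (N + 1)]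

/-- [folklore] -/
theorem mag_expSmall_le (hM : mag Z ≤ 1) (N : ℕ) : mag (expSmall N Z) ≤ 5 := by
  have h := mag_widen_le (expTaylor Z (N + 1)) (expRem (N + 1))
  rw [abs_of_nonneg (expRem_nonneg _)] at h
  have h1 := mag_expTaylor_le hM (N + 1)
  have h2 := expRem_succ_le_one N
  rw [expSmall]; linarith

/-- [folklore] -/
theorem mag_sqIter_le (A : CBox) (s : ℕ) : mag (sqIter s A) ≤ mag A ^ (2 ^ s) := by
  induction s generalizing A with
  | zero => simp [sqIter]
  | succ s ih =>
    calc mag (sqIter (s + 1) A) = mag (sqIter s (mul A A)) := rfl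
      _ ≤ mag (mul A A) ^ (2 ^ s) := ih _
      _ ≤ (mag A * mag A) ^ (2 ^ s) := pow_le_pow_left₀ (mag_nonneg _) (mag_mul_le _ _) _
      _ = mag A ^ (2 ^ (s + 1)) := by rw [← sq, ← pow_mul, pow_succ']

/-- Width of iterated squaring: `μ W(sqIter s A) ≤ 2^s μ^{2^s} W(A)` for `M(A) ≤ μ`, `1 ≤ μ`
(i.e. `W ≤ 2^s μ^{2^s - 1} W(A)`). [folklore] -/
theorem width_sqIter_le {μ : ℚ} (hμ : 1 ≤ μ) (A : CBox) (hA : mag A ≤ μ) (s : ℕ) :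
    μ * width (sqIter s A) ≤ 2 ^ s * μ ^ (2 ^ s) * width A := by
  induction s generalizing A μ with
  | zero => simp [sqIter]
  | succ s ih =>
    have hμ0 : 0 < μ := zero_lt_one.trans_le hμ
    have hμ2 : 1 ≤ μ ^ 2 := one_le_pow₀ hμ
    have hAA : mag (mul A A) ≤ μ ^ 2 :=
      (mag_mul_le _ _).trans (by rw [sq]; exact mul_le_mul hA hA (mag_nonneg _) hμ0.le)
    have hWAA : width (mul A A) ≤ 2 * μ * width A := by
      have := width_mul_le A A
      nlinarith [width_nonneg A, mag_nonneg A]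
    have h := ih hμ2 (mul A A) hAA
    have h' : μ ^ 2 * width (sqIter s (mul A A)) ≤ 2 ^ s * (μ ^ 2) ^ (2 ^ s) * (2 * μ * width A) :=
      h.trans (mul_le_mul_of_nonneg_left hWAA (by positivity))
    have hkey : μ * (μ * width (sqIter (s + 1) A)) ≤ μ * (2 ^ (s + 1) * μ ^ (2 ^ (s + 1)) * width A) := by
      have e1 : μ * (μ * width (sqIter (s + 1) A)) = μ ^ 2 * width (sqIter s (mul A A)) := by
        rw [sq, mul_assoc]; rfl
      have e2 : μ * (2 ^ (s + 1) * μ ^ (2 ^ (s + 1)) * width A) =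
          2 ^ s * (μ ^ 2) ^ (2 ^ s) * (2 * μ * width A) := by
        rw [← pow_mul, ← pow_succ']; ring
      rw [e1, e2]; exact h'
    exact le_of_mul_le_mul_left hkey hμ0

/-- After scaling by `2^{-expScale}` the box has magnitude `≤ 1`. [folklore] -/
theorem mag_smul_expScale_le_one (Z : CBox) : mag (smul (1 / 2 ^ expScale Z) Z) ≤ 1 := by
  set s := expScale Z
  have h1 : mag (smul (1 / 2 ^ s) Z) ≤ 1 / 2 ^ s * mag Z := by
    have := mag_smul_le (1 / 2 ^ s) Z
    rwa [abs_of_nonneg (by positivity)] at this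
  have h2 : mag Z ^ 2 ≤ 2 * normSqHi Z := by
    simp only [mag, normSqHi]
    nlinarith [sq_nonneg (intervalMag Z.re - intervalMag Z.im)]
  have h3 : (4 * normSqHi Z : ℚ) ≤ (4 : ℚ) ^ s := by
    have hceil : (4 * normSqHi Z : ℚ) ≤ (⌈4 * normSqHi Z⌉₊ : ℕ) := Nat.le_ceil _
    have hclog : (⌈4 * normSqHi Z⌉₊ : ℕ) ≤ 4 ^ s := Nat.le_pow_clog (by norm_num) _
    exact hceil.trans (by exact_mod_cast hclog)
  have h4 : (1 / 2 ^ s * mag Z) ^ 2 ≤ 1 := by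
    have h2s : (0 : ℚ) < 2 ^ s := by positivity
    have : ((2 : ℚ) ^ s) ^ 2 = 4 ^ s := by rw [← pow_mul, mul_comm, pow_mul]; norm_num
    rw [mul_pow, div_pow, one_pow, this]
    rw [div_mul_eq_mul_div, one_mul, div_le_one (by positivity)]
    have h4s : (0 : ℚ) < 4 ^ s := by positivity
    linarith
  have h5 : 0 ≤ 1 / 2 ^ s * mag Z := by have := mag_nonneg Z; positivity
  exact h1.trans ((pow_le_one_iff_of_nonneg h5 two_ne_zero).1 h4)

/-- [folklore] -/
theorem expScale_le {μ : ℚ} (h : normSqHi Z ≤ μ) : expScale Z ≤ Nat.clog 4 ⌈4 * μ⌉₊ :=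
  Nat.clog_mono_right _ (Nat.ceil_le_ceil (by linarith))

/-- **Width and magnitude of the exponential enclosure.** On boxes with `normSqHi ≤ μ` there is
a constant `C` with `W(cexp N Z) ≤ C (W(Z) + expRem (N+1))` and `M(cexp N Z) ≤ C` for all `N`:
the width is controlled by the width of the argument and by the precision alone. [folklore] -/
theorem width_mag_cexp_le (μ : ℚ) : ∃ C : ℚ, 0 ≤ C ∧ ∀ (N : ℕ) (Z : CBox), normSqHi Z ≤ μ →
    width (cexp N Z) ≤ C * (width Z + expRem (N + 1)) ∧ mag (cexp N Z) ≤ C := by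
  set smax := Nat.clog 4 ⌈4 * μ⌉₊ with hsmax
  refine ⟨4 * 2 ^ smax * 5 ^ (2 ^ smax), by positivity, fun N Z hZ => ?_⟩
  set s := expScale Z with hs
  have hsle : s ≤ smax := expScale_le hZ
  set Zs := smul (1 / 2 ^ s) Z with hZs
  have hZs1 : mag Zs ≤ 1 := mag_smul_expScale_le_one Z
  set E := expSmall N Zs with hE
  have hE5 : mag E ≤ 5 := mag_expSmall_le hZs1 N
  have hEw : width E ≤ 3 * width Zs + 4 * expRem (N + 1) := width_expSmall_le hZs1 N
  have hZsw : width Zs ≤ width Z := by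
    refine (width_smul_le _ _).trans ?_
    rw [abs_of_nonneg (by positivity)]
    refine mul_le_of_le_one_left (width_nonneg _) ?_
    rw [div_le_one (by positivity)]
    exact one_le_pow₀ (by norm_num)
  have h5 : (1 : ℚ) ≤ 5 := by norm_num
  have hsq := width_sqIter_le h5 E hE5 s
  have hW0 := width_nonneg (sqIter s E)
  have hmono : (2 : ℚ) ^ s * 5 ^ (2 ^ s) ≤ 2 ^ smax * 5 ^ (2 ^ smax) :=
    mul_le_mul (pow_le_pow_right₀ (by norm_num) hsle)
      (pow_le_pow_right₀ (by norm_num) (Nat.pow_le_pow_right two_pos hsle))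
      (by positivity) (by positivity)
  have hcexp : cexp N Z = sqIter s E := rfl
  rw [hcexp]
  constructor
  · have h1 : width (sqIter s E) ≤ 2 ^ s * 5 ^ (2 ^ s) * width E := by nlinarith
    have hR := expRem_nonneg (N + 1)
    have hWZ := width_nonneg Z
    calc width (sqIter s E) ≤ 2 ^ s * 5 ^ (2 ^ s) * width E := h1
      _ ≤ 2 ^ smax * 5 ^ (2 ^ smax) * (3 * width Z + 4 * expRem (N + 1)) :=
          mul_le_mul hmono (hEw.trans (by linarith)) (width_nonneg _) (by positivity)
      _ ≤ 2 ^ smax * 5 ^ (2 ^ smax) * (4 * (width Z + expRem (N + 1))) := by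
          gcongr; linarith
      _ = 4 * 2 ^ smax * 5 ^ (2 ^ smax) * (width Z + expRem (N + 1)) := by ring
  · calc mag (sqIter s E) ≤ mag E ^ (2 ^ s) := mag_sqIter_le _ _
      _ ≤ 5 ^ (2 ^ s) := pow_le_pow_left₀ (mag_nonneg _) hE5 _
      _ ≤ 5 ^ (2 ^ smax) := pow_le_pow_right₀ (by norm_num) (Nat.pow_le_pow_right two_pos hsle)
      _ ≤ 4 * 2 ^ smax * 5 ^ (2 ^ smax) := by
          have : (1 : ℚ) ≤ 4 * 2 ^ smax := by
            have := one_le_pow₀ (M₀ := ℚ) (a := 2) (by norm_num) (n := smax); linarith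
          have h5pos : (0 : ℚ) < 5 ^ (2 ^ smax) := by positivity
          nlinarith

/-! ### The polynomial enclosure: width and magnitude -/

/-- [folklore] -/
theorem sum_varList {n : ℕ} (g : Fin n ⊕ Fin n → ℚ) : ((varList n).map g).sum = ∑ k, g k := by
  rw [Fintype.sum_sum_type, Fin.sum_univ_def, Fin.sum_univ_def, varList, List.map_append,
    List.sum_append, List.map_map, List.map_map]
  rfl

/-- Width and magnitude of a monomial enclosure, for argument boxes of magnitude `≤ μ`.
[folklore] -/
theorem width_mag_monoEncl_le {n : ℕ} (d : (Fin n ⊕ Fin n) →₀ ℕ) {μ : ℚ} (hμ : 1 ≤ μ) :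
    ∃ C : ℚ, 0 ≤ C ∧ ∀ A : Fin n ⊕ Fin n → CBox, (∀ k, mag (A k) ≤ μ) →
      width (monoEncl d A) ≤ C * ∑ k, width (A k) ∧ mag (monoEncl d A) ≤ C := by
  have hμ0 : 0 ≤ μ := zero_le_one.trans hμ
  set D := d.degree with hD
  set M := μ ^ D with hM
  have hM1 : 1 ≤ M := one_le_pow₀ hμ
  set L := (varList n).length
  refine ⟨M ^ L * (D * M) + M ^ L, by positivity, fun A hA => ?_⟩
  have hdk : ∀ k, d k ≤ D := fun k => by rw [hD]; exact Finsupp.le_degree k d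
  have hfac : ∀ k ∈ varList n, mag (npow (A k) (d k)) ≤ M ∧
      width (npow (A k) (d k)) ≤ (fun k => D * M * width (A k)) k := by
    intro k _
    have hmk : ∀ e, e ≤ D → mag (A k) ^ e ≤ M := fun e he =>
      (pow_le_pow_left₀ (mag_nonneg _) (hA k) e).trans (pow_le_pow_right₀ hμ he)
    refine ⟨(mag_npow_le _ _).trans (hmk _ (hdk k)), ?_⟩
    rcases h : d k with _ | e
    · simp only [npow, width_one]
      have := width_nonneg (A k); positivity
    · have he : e + 1 ≤ D := h ▸ hdk k
      calc width (npow (A k) (e + 1)) ≤ (e + 1) * mag (A k) ^ e * width (A k) :=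
            width_npow_succ_le _ _
        _ ≤ D * M * width (A k) := by
            have h1 : ((e : ℚ) + 1) ≤ D := by exact_mod_cast he
            have h2 : mag (A k) ^ e ≤ M := hmk e (by omega)
            have h3 := width_nonneg (A k)
            have h4 : 0 ≤ mag (A k) ^ e := pow_nonneg (mag_nonneg _) _
            gcongr
  obtain ⟨hm, hw⟩ := mag_width_lprod_le (varList n) (fun k => npow (A k) (d k)) hM1
    (fun k => D * M * width (A k)) (fun k _ => by have := width_nonneg (A k); positivity) hfac
  have hsum : ((varList n).map fun k => D * M * width (A k)).sum = D * M * ∑ k, width (A k) := by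
    rw [← sum_varList, List.sum_map_mul_left]
  refine ⟨?_, ?_⟩
  · calc width (monoEncl d A) = width (lprod (varList n) fun k => npow (A k) (d k)) := rfl
      _ ≤ M ^ L * (D * M * ∑ k, width (A k)) := by rw [← hsum]; exact hw
      _ ≤ (M ^ L * (D * M) + M ^ L) * ∑ k, width (A k) := by
          have hS : 0 ≤ ∑ k, width (A k) := Finset.sum_nonneg fun k _ => width_nonneg _
          nlinarith [pow_nonneg (zero_le_one.trans hM1) L]
  · calc mag (monoEncl d A) = mag (lprod (varList n) fun k => npow (A k) (d k)) := rfl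
      _ ≤ M ^ L := hm
      _ ≤ M ^ L * (D * M) + M ^ L := by
          have : 0 ≤ M ^ L * (D * M) := by positivity
          linarith

/-- **Width and magnitude of the polynomial enclosure**, for argument boxes of magnitude
`≤ μ`: `W(polyEncl p A) ≤ C ∑ₖ W(A k)` and `M(polyEncl p A) ≤ C`. [folklore] -/
theorem width_mag_polyEncl_le {n : ℕ} (p : MvPolynomial (Fin n ⊕ Fin n) ℤ) {μ : ℚ} (hμ : 1 ≤ μ) :
    ∃ C : ℚ, 0 ≤ C ∧ ∀ A : Fin n ⊕ Fin n → CBox, (∀ k, mag (A k) ≤ μ) →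
      width (polyEncl p A) ≤ C * ∑ k, width (A k) ∧ mag (polyEncl p A) ≤ C := by
  choose Cd hCd0 hCd using fun d : (Fin n ⊕ Fin n) →₀ ℕ => width_mag_monoEncl_le d hμ
  set l := p.support.toList
  set c : ((Fin n ⊕ Fin n) →₀ ℕ) → ℚ := fun d => |((p.coeff d : ℤ) : ℚ)| * Cd d with hc
  have hc0 : ∀ d, 0 ≤ c d := fun d => mul_nonneg (abs_nonneg _) (hCd0 d)
  refine ⟨(l.map c).sum, List.sum_nonneg (fun x hx => ?_), fun A hA => ?_⟩
  · obtain ⟨d, -, rfl⟩ := List.mem_map.1 hx; exact hc0 d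
  have hS : 0 ≤ ∑ k, width (A k) := Finset.sum_nonneg fun k _ => width_nonneg _
  refine ⟨?_, ?_⟩
  · have h := width_lsum_le l (fun d => smul ((p.coeff d : ℤ) : ℚ) (monoEncl d A))
      (fun d => c d * ∑ k, width (A k)) (fun d _ => by
        refine (width_smul_le _ _).trans ?_
        rw [hc, mul_assoc]
        exact mul_le_mul_of_nonneg_left ((hCd d A hA).1) (abs_nonneg _))
    calc width (polyEncl p A) ≤ (l.map fun d => c d * ∑ k, width (A k)).sum := h
      _ = (l.map c).sum * ∑ k, width (A k) := by rw [List.sum_map_mul_right]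
  · exact mag_lsum_le l _ c fun d _ =>
      (mag_smul_le _ _).trans (mul_le_mul_of_nonneg_left ((hCd d A hA).2) (abs_nonneg _))

/-! ### Magnitudes of boxes with a known member -/

/-- `M(A) ≤ |Re z| + |Im z| + W(A)` for `z ∈ A`. [folklore] -/
theorem mag_le_of_mem {z : ℂ} (hz : z ∈ A) : (mag A : ℝ) ≤ |z.re| + |z.im| + width A := by
  have h1 := intervalMag_le_abs_add_length hz.1
  have h2 := intervalMag_le_abs_add_length hz.2
  have hl1 : (0 : ℝ) ≤ A.re.length := by exact_mod_cast length_nonneg A.re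
  have hl2 : (0 : ℝ) ≤ A.im.length := by exact_mod_cast length_nonneg A.im
  simp only [mag, width, Rat.cast_add]
  linarith

/-- `M(A) ≤ 2 ‖z‖ + W(A)` for `z ∈ A`. [folklore] -/
theorem mag_le_two_mul_norm_add_width {z : ℂ} (hz : z ∈ A) : (mag A : ℝ) ≤ 2 * ‖z‖ + width A := by
  have := mag_le_of_mem hz
  linarith [Complex.abs_re_le_norm z, Complex.abs_im_le_norm z]

/-- `normSqHi A ≤ 2 (‖z‖ + W(A))²` for `z ∈ A`. [folklore] -/
theorem normSqHi_le_of_mem {z : ℂ} (hz : z ∈ A) :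
    (normSqHi A : ℝ) ≤ 2 * (‖z‖ + width A) ^ 2 := by
  have h1 := intervalMag_le_abs_add_length hz.1
  have h2 := intervalMag_le_abs_add_length hz.2
  have hl1 : (0 : ℝ) ≤ A.re.length := by exact_mod_cast length_nonneg A.re
  have hl2 : (0 : ℝ) ≤ A.im.length := by exact_mod_cast length_nonneg A.im
  have hm1 : (0 : ℝ) ≤ intervalMag A.re := by exact_mod_cast intervalMag_nonneg A.re
  have hm2 : (0 : ℝ) ≤ intervalMag A.im := by exact_mod_cast intervalMag_nonneg A.im
  have hre := Complex.abs_re_le_norm z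
  have him := Complex.abs_im_le_norm z
  have hw : (width A : ℝ) = A.re.length + A.im.length := by simp [width]
  simp only [normSqHi, Rat.cast_add, Rat.cast_pow]
  rw [hw]
  nlinarith [abs_nonneg z.re, abs_nonneg z.im]

end CBox

end Literature.NumberTheory.Transcendental
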